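import Summits.Ventures.HodgeRepro.Night4KnownRegime

/-!
# ROUTE.md §2 row «S4 known part: W_F(B) motivated» (L46, LITMAP L0.9) typed as printed: André 1996 Théorème 0.6.2

Blind re-derivation cell `pub-hodge-repro`, seat `night-4` (ROUTE HARDENING for the Monday FINAL, gen 2).  Target tree path
`lean/Summits/Ventures/HodgeRepro/Night4Motivated.lean`.

ROUTE.md §1 row S4 records what is KNOWN for every split-Weil `B`: «W_F(B) consists of ABSOLUTE Hodge classes (D1 Thm 4.8,
L3.4) and of MOTIVATED classes (A1 0.6.2, L0.9)».  The held source: Y. André, *Pour une théorie inconditionnelle des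
motifs*, Publ. Math. IHÉS 83 (1996), store `paper:doi-10-1007-bf02698643` p0006:L5–8 (printed p. 9; read by the seat
2026-08-24T08:05Z), verbatim (the OCR layer garbles the displayed cycle; the sentence is quoted as materialised):

«Théorème 0.6.2. — Tout cycle de Hodge ξ sur une variété abélienne A est motivé. Plus précisément, ξ est somme de cycles
de la forme p_*(α ∪ *β) [OCR: «p^ u *^ (B)»], où α et β sont des cycles algébriques sur A × B × Y_1 × … × Y_n, B désignant
une variété abélienne, Y_i l'espace total d'un pinceau compact de variétés abéliennes, et p la projection sur A.»

Typed over `MotivatedData extends KnownRegimeData` with the subspace `motivated p X ⊂ H^{2p}(X, ℚ)(p)` of motivated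
classes (André §2; a field asserting nothing): `Andre1996_0_6_2` (every Hodge class on an abelian variety is motivated),
`AlgIsMotivated` (algebraic classes are motivated — André's definition of motivated cycles, §2, contains the algebraic
cycles; stated as a named clause, not re-derived here), and the route-level readings: `weil_le_motivated` (the L46 row itself) and
`S4_of_motivated_le_alg` — André's theorem reduces S4 to «motivated ⇒ algebraic» on the split-Weil corner products
(André's own formulation of the Hodge conjecture's remaining content, p0003:L27–28: «la théorie n'est vraiment utile que
si l'on dispose d'assez de cycles motivés — c'est-à-dire algébriques, selon la définition …»).  NO open input is closed; HC_CM is NOT proved;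
nothing here asserts anything about the original programme.
-/

namespace HodgeRepro.Route

/-- **The interface**: `KnownRegimeData` (`IsAbelian`, …) with the motivated classes of André 1996 §2 as a subspace of
each `H^{2p}(X, ℚ)(p)`.  The field asserts nothing. -/
structure MotivatedData extends KnownRegimeData where
  /-- the motivated classes of codimension `p` on `X` (André 1996 §2) -/
  motivated : ∀ (p : ℕ) (X : Var), Submodule ℚ (H p X)

variable (𝓜 : MotivatedData)

/-- **André 1996, Théorème 0.6.2** — store p0006:L5–8 (quoted in the module docstring): every Hodge class on an abelian
variety is motivated.  PRINTED. -/
def Andre1996_0_6_2 : Prop :=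
  ∀ X : 𝓜.Var, 𝓜.IsAbelian X → ∀ p : ℕ, 𝓜.hodge p X ≤ 𝓜.motivated p X

/-- **Algebraic classes are motivated** — André 1996 §2 (the definition of motivated cycles contains the algebraic
cycles).  PRINTED / definitional; a named clause, not re-derived here. -/
def AlgIsMotivated : Prop :=
  ∀ (p : ℕ) (X : 𝓜.Var), 𝓜.alg p X ≤ 𝓜.motivated p X

/-- **ROUTE.md §2 row L46 — the Weil line consists of motivated classes**: `W_F(B) ⊂ Hdg^p(B)` (Deligne §5 (c),
`WeilIsHodge`) on the abelian variety `B`, and Hodge classes on abelian varieties are motivated (André 0.6.2). -/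
theorem weil_le_motivated (hA : Andre1996_0_6_2 𝓜) (hW : WeilIsHodge 𝓜.toRouteData)
    (hSW : ∀ (p : ℕ) (B : 𝓜.Var), 𝓜.SplitWeil p B → 𝓜.IsAbelian B) (p : ℕ) (B : 𝓜.Var) (hB : 𝓜.SplitWeil p B) :
    𝓜.weil p B ≤ 𝓜.motivated p B :=
  (hW p B hB).trans (hA B (hSW p B hB) p)

/-- **André's theorem reduces S4 to «motivated ⇒ algebraic» on the split-Weil corner products**: if every motivated
class of codimension `p` on a split-Weil `B` is algebraic, S4 holds. -/
theorem S4_of_motivated_le_alg (hA : Andre1996_0_6_2 𝓜) (hW : WeilIsHodge 𝓜.toRouteData)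
    (hSW : ∀ (p : ℕ) (B : 𝓜.Var), 𝓜.SplitWeil p B → 𝓜.IsAbelian B)
    (hMA : ∀ (p : ℕ) (B : 𝓜.Var), 𝓜.SplitWeil p B → 𝓜.motivated p B ≤ 𝓜.alg p B) : S4 𝓜.toRouteData :=
  fun p _ B hB => (weil_le_motivated 𝓜 hA hW hSW p B hB).trans (hMA p B hB)

/-- **… and S0 to «motivated ⇒ algebraic» on the CM abelian varieties themselves**: with André 0.6.2, HC for a CM abelian
variety `A` is exactly the statement that its motivated classes are algebraic. -/
theorem S0_of_motivated_le_alg (hA : Andre1996_0_6_2 𝓜) (hCM : ∀ A : 𝓜.Var, 𝓜.IsCM A → 𝓜.IsAbelian A)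
    (hMA : ∀ A : 𝓜.Var, 𝓜.IsCM A → ∀ p : ℕ, 𝓜.motivated p A ≤ 𝓜.alg p A) : S0 𝓜.toRouteData :=
  fun A hAc p => (hA A (hCM A hAc) p).trans (hMA A hAc p)

/-- **The converse direction**: on a CM abelian variety satisfying HC, motivated classes that are Hodge classes are
algebraic — so, given `AlgIsMotivated` and that motivated classes are Hodge classes, `S0` is EQUIVALENT to
«motivated = algebraic» on CM abelian varieties (the direction `S0 ⇒` here). -/
theorem motivated_le_alg_of_S0 (h0 : S0 𝓜.toRouteData) (hMH : ∀ (p : ℕ) (X : 𝓜.Var), 𝓜.motivated p X ≤ 𝓜.hodge p X)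
    (A : 𝓜.Var) (hAc : 𝓜.IsCM A) (p : ℕ) : 𝓜.motivated p A ≤ 𝓜.alg p A :=
  (hMH p A).trans (h0 A hAc p)

end HodgeRepro.Route
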